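import Summits.BirchSwinnertonDyer.BirchSwinnertonDyer.Theorems.GenusKolyvaginAtTwoShaCardDvdPowAtTwoREntanglement
import Literature.NumberTheory.EllipticCurves.DivisionTowerH1OrderTwoSurjective
import Literature.NumberTheory.EllipticCurves.HeegnerPointsKolyvaginConjugation
import HarnessLib

/-!
# Route `GenusKolyvaginAtTwo`: the «phantom `ℤ/2`» `H¹(K(E[2^M])/K, E[2^M])` is killed by `2` and
# FIXED by `Gal(K/ℚ)` — the two displayed inputs `hN2`, `hNfix` of the (H2′) repair discharged modulo
# `2^M`-surjectivity over `K` (Lawson–Wuthrich at the even prime, this seat's Literature chain)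

Lead seat `bsd-line-gk2-p1` g11 (crux stmt-BirchSwinnertonDyer-22136). THEOREMS ONLY (no definition, no named fact,
no `sorry`); helper `--supports stmt-BirchSwinnertonDyer-22136`; no item is closed; BSD is not proved by any of this.

WHY. gk2-p3 g14's repaired habitat condition (H2′) for the `ℚ`-pair frame of LINE 6/13 at `2`
(`VisiblePairAtTwo.sel_visible_two_of_kernel_inputs`, file `…ShaCardDvdPowAtTwoREntanglement`) is proved modulo two
displayed inputs on the kernel `N = {y ∈ H¹(K, E[2^M]) : [y, ρ] = 0 ∀ ρ ∈ Γ_{K(E[2^M])}}` (the inflation of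
`H¹(K(E[2^M])/K, E[2^M])`, the «LW phantom ℤ/2» of the route file): `hN2 : 2N = 0` and `hNfix : σ₀` (the non-trivial
automorphism of `K`) `acts trivially on N`. Both follow from this seat's Literature theorems once `ρ̄_{E,2^M}` is
surjective OVER `K` (`(W.baseChange K).HasSurjectiveModNGaloisRep (2^M)`; its transfer from `ℚ` under the habitat's
side conditions is gk2-p3 g15's announced task):

* `hN2_of_hasSurjectiveModNGaloisRep_baseChange` — `2y = 0` on `N`
  (`LawsonWuthrich2016.two_zsmul_eq_zero_of_forall_h1Eval_eq_zero_of_hasSurjectiveModNGaloisRep`);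
* `conjAct_mem_kernel` — for `K` imaginary quadratic and ANY `σ₀ ∈ Aut(K/ℚ)`, `conjAct σ₀` maps `N` into `N`
  (involutive lift of complex conjugation, `IsLiftOfAut.h1Eval_conjAct`);
* `hNfix_of_hasSurjectiveModNGaloisRep_baseChange` — `σ₀` acts TRIVIALLY on `N`: `N` has at most two elements
  (`LawsonWuthrich2016.eq_zero_or_eq_zero_or_eq_of_forall_h1Eval_eq_zero`), an additive involution preserving
  `N` fixes it pointwise;
* **`sel_visible_two_of_hasSurjectiveModNGaloisRep_baseChange`** — (H2′) with `hNfix`, `hN2` DISCHARGED: on the habitat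
  (`ρ̄_{E,2}` onto over `ℚ`, `K` imaginary quadratic, `ρ̄_{E,2^M}` onto over `K`, `M ≥ 1`) every pair `s₁ ∈ Sel(E)`,
  `s₂ ∈ Sel(E^{(d_K)})` tied over `K` (`rK₁ s₁ + rK₂ s₂ = 0`) satisfies `2 s₁ = 0 ∧ 2 s₂ = 0`.

References: [LawsonWuthrich2016] §7.1; [McCallumLMS1991] p. 299; [GrossLMS1991] §3 (involutive lift), §5 (5.1), §9.
-/

set_option linter.dupNamespace false -- tree convention: `Summit.BirchSwinnertonDyer.BirchSwinnertonDyer.Theorems`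
set_option autoImplicit false

noncomputable section

open scoped Classical

namespace Summit.BirchSwinnertonDyer.BirchSwinnertonDyer.Theorems.GenusKolyKernelAtTwo

open WeierstrassCurve NumberField Field
open Literature.NumberTheory.EllipticCurves Literature.NumberTheory.GaloisRepresentations
open Summit.BirchSwinnertonDyer.BirchSwinnertonDyer.Theorems.GenusExact.VisiblePairAtTwo

variable (W : WeierstrassCurve ℚ) [W.IsElliptic] (K : Type) [Field K] [NumberField K] (j : ℕ)

/-- **`hN2`: the phantom kernel is killed by `2`.** For `ρ̄_{E,2^{j+1}}` surjective over `K`, every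
`y ∈ H¹(K, E_K[2^{j+1}])` with `[y, ρ] = 0` for all `ρ ∈ Γ_{K(E[2^{j+1}])}` satisfies `2y = 0`.
[cite: LawsonWuthrich2016, §7.1] [cite: McCallumLMS1991, p. 299] -/
theorem hN2_of_hasSurjectiveModNGaloisRep_baseChange
    (hsK : (W.baseChange K).HasSurjectiveModNGaloisRep ((2 ^ (j + 1) : ℕ) : ℤ))
    (y : galH1Torsion (W.baseChange K) ((2 ^ (j + 1) : ℕ) : ℤ))
    (hy : ∀ ρ : torsionFixing (W.baseChange K) ((2 ^ (j + 1) : ℕ) : ℤ),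
      h1Eval (W.baseChange K) ((2 ^ (j + 1) : ℕ) : ℤ) y ρ = 0) :
    (2 : ℤ) • y = 0 :=
  LawsonWuthrich2016.two_zsmul_eq_zero_of_forall_h1Eval_eq_zero_of_hasSurjectiveModNGaloisRep
    (W.baseChange K) (by exact_mod_cast pow_ne_zero _ two_ne_zero) hsK (fun ρ hρ ↦ hy ⟨ρ, hρ⟩)

omit [W.IsElliptic] in
/-- **`Gal(K/ℚ)` preserves the phantom kernel**: for `K` imaginary quadratic and any `σ₀ ∈ Aut(K/ℚ)`, if
`[y, ρ] = 0` for all `ρ ∈ Γ_{K(E[n])}` then the same holds for `σ₀ · y` (via an involutive lift of complex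
conjugation, `[σ₀·y, ρ] = τ [y, τ⁻¹ρτ]`). [cite: GrossLMS1991, §3 (proof of Prop. 3.6) and §9] -/
theorem conjAct_mem_kernel (hK : IsImaginaryQuadratic K) (σ₀ : K ≃ₐ[ℚ] K) (n : ℤ)
    (y : galH1Torsion (W.baseChange K) n)
    (hy : ∀ ρ : torsionFixing (W.baseChange K) n, h1Eval (W.baseChange K) n y ρ = 0) :
    ∀ ρ : torsionFixing (W.baseChange K) n, h1Eval (W.baseChange K) n (conjAct W σ₀ n y) ρ = 0 := by
  intro ρ
  by_cases hσ : σ₀ = 1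
  · subst hσ
    rw [conjAct_one, AddMonoidHom.id_apply]
    exact hy ρ
  · haveI : Algebra.IsAlgebraic ℚ K := Algebra.IsAlgebraic.of_finite ℚ K
    obtain ⟨c₀, hc₀⟩ := exists_isComplexConjugation (Rat.castHom ℝ)
    have ht : IsLiftOfAut σ₀ (absGaloisTransport (K := ℚ) (L := K) c₀).toRingEquiv :=
      RatClosure.isLiftOfAut_absGaloisTransport_of_isImaginaryQuadratic hK hσ hc₀
    have hinv : ∀ x, (absGaloisTransport (K := ℚ) (L := K) c₀).toRingEquiv
        ((absGaloisTransport (K := ℚ) (L := K) c₀).toRingEquiv x) = x := fun x ↦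
      RatClosure.absGaloisTransport_absGaloisTransport_of_sq_eq_one hc₀.sq_eq_one x
    rw [ht.h1Eval_conjAct W n y ρ.2, hy ⟨_, ht.conjGalCMH_mem_torsionFixing W hinv n ρ.2⟩, map_zero]

omit W [W.IsElliptic] j in
/-- `σ₀² = 1` in `Aut(K/ℚ)` for `K` quadratic. [folklore] -/
private theorem sq_eq_one_of_quadratic (hK : IsImaginaryQuadratic K) (σ₀ : K ≃ₐ[ℚ] K) : σ₀ * σ₀ = 1 := by
  haveI : Algebra.IsQuadraticExtension ℚ K := ⟨hK.1⟩
  have hcard : Nat.card (K ≃ₐ[ℚ] K) = 2 := by rw [IsGalois.card_aut_eq_finrank, hK.1]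
  have h := pow_card_eq_one' (G := K ≃ₐ[ℚ] K) (x := σ₀)
  rwa [hcard, pow_two] at h

/-- **`hNfix`: `Gal(K/ℚ)` acts TRIVIALLY on the phantom kernel.** For `K` imaginary quadratic, `ρ̄_{E,2^{j+1}}`
surjective over `K` and any `σ₀ ∈ Aut(K/ℚ)`: a class `y` with `[y, ρ] = 0` for all `ρ ∈ Γ_{K(E[2^{j+1}])}`
satisfies `σ₀ · y = y` — the kernel has at most two elements
(`LawsonWuthrich2016.eq_zero_or_eq_zero_or_eq_of_forall_h1Eval_eq_zero`) and `σ₀` is an additive involution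
preserving it. [cite: LawsonWuthrich2016, §7.1] [cite: GrossLMS1991, §5 (5.1)] -/
theorem hNfix_of_hasSurjectiveModNGaloisRep_baseChange (hK : IsImaginaryQuadratic K)
    (hsK : (W.baseChange K).HasSurjectiveModNGaloisRep ((2 ^ (j + 1) : ℕ) : ℤ)) (σ₀ : K ≃ₐ[ℚ] K)
    (y : galH1Torsion (W.baseChange K) ((2 ^ (j + 1) : ℕ) : ℤ))
    (hy : ∀ ρ : torsionFixing (W.baseChange K) ((2 ^ (j + 1) : ℕ) : ℤ),
      h1Eval (W.baseChange K) ((2 ^ (j + 1) : ℕ) : ℤ) y ρ = 0) :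
    conjAct W σ₀ ((2 ^ (j + 1) : ℕ) : ℤ) y = y := by
  have hy' := conjAct_mem_kernel W K hK σ₀ _ y hy
  have h2K : (2 : K) ≠ 0 := two_ne_zero
  rcases LawsonWuthrich2016.eq_zero_or_eq_zero_or_eq_of_forall_h1Eval_eq_zero (W.baseChange K) j h2K hsK
      (fun ρ hρ ↦ hy ⟨ρ, hρ⟩) (fun ρ hρ ↦ hy' ⟨ρ, hρ⟩) with h0 | h0 | h0
  · rw [h0, map_zero]
  · -- `σ₀ y = 0` forces `y = σ₀ (σ₀ y) = 0`
    have hinv := conjAct_conjAct_of_mul_self W (sq_eq_one_of_quadratic K hK σ₀) ((2 ^ (j + 1) : ℕ) : ℤ) y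
    rw [h0, map_zero] at hinv
    rw [← hinv, map_zero]
  · exact h0.symm

/-- **(H2′) with its kernel inputs DISCHARGED** (modulo `2^M`-surjectivity over `K`, `M = j + 1 ≥ 1`): on the
habitat `ρ̄_{E,2}` onto over `ℚ`, `K` imaginary quadratic with `θ² = d_K`, and `ρ̄_{E,2^M}` onto over `K`, every
`s₁ ∈ Sel^{(2^M)}(E/ℚ)`, `s₂ ∈ Sel^{(2^M)}(E^{(d_K)}/ℚ)` with `rK₁ s₁ + rK₂ s₂ = 0` satisfy `2 s₁ = 0 ∧ 2 s₂ = 0` —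
gk2-p3 g14's `sel_visible_two_of_kernel_inputs` fed with `hNfix_of_…`, `hN2_of_…`.
[cite: McCallumLMS1991, p. 299] [cite: LawsonWuthrich2016, §7.1] -/
theorem sel_visible_two_of_hasSurjectiveModNGaloisRep_baseChange (hK : IsImaginaryQuadratic K)
    (h2 : Module.finrank ℚ K = 2) {θ : K} (hθ : θ ∉ Set.range (algebraMap ℚ K))
    (hθsq : θ ^ 2 = algebraMap ℚ K ((NumberField.discr K : ℤ) : ℚ))
    (hs : W.HasSurjectiveModNGaloisRep 2)
    (hsK : (W.baseChange K).HasSurjectiveModNGaloisRep ((2 ^ (j + 1) : ℕ) : ℤ)) :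
    ∀ s₁ ∈ selmerGroup W (lvl (j + 1)), ∀ s₂ ∈ selmerGroup (twin W K) (lvl (j + 1)),
      rK₁ W K (j + 1) s₁ + rK₂ W (j + 1) hθ hθsq s₂ = 0 → (2 : ℤ) • s₁ = 0 ∧ (2 : ℤ) • s₂ = 0 :=
  sel_visible_two_of_kernel_inputs W K (j + 1) h2 hθ hθsq hs
    (fun y hy ↦ hNfix_of_hasSurjectiveModNGaloisRep_baseChange W K j hK hsK _ y hy)
    (fun y hy ↦ hN2_of_hasSurjectiveModNGaloisRep_baseChange W K j hsK y hy)

end Summit.BirchSwinnertonDyer.BirchSwinnertonDyer.Theorems.GenusKolyKernelAtTwo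

end
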